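import Summits.Ventures.Crystal3D.Theorems.StickyWulffConstantNoReconstructionGainNoK1122
import HarnessLib

/-!
# A criminal has at least TEN off-lattice balls (criminal anatomy, line `replication-exactness`)

HONEST FRAMING. Venture `Summits/Ventures/Crystal3D` (cell `crystal3d-full`), helper `--supports` the crux `NoReconstructionGain`
(stmt-Ventures-19144), lead wulff-p1 g19.  Sharpens `nine_le_card_offLattice_of_criminal` (p697069) by one: nine off-lattice balls
would have `> 54` ordered contacts, i.e. `≤ 8` non-touching pairs; three balls cover all but `≤ 2` of them (greedy: a ball meeting
two bad pairs, else the bad pairs form a matching); six balls with `≤ 2` non-touching pairs contain five pairwise touching balls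
(`no_five_pairwise_dist_two`) unless the two pairs are disjoint = `K_{1,1,2,2}`, excluded by `no_K1122_contacts`.
Main: `ten_le_card_offLattice_of_criminal`.  WHAT THIS IS NOT: the crux; `#Q_off ≥ 11` needs more forbidden patterns.
-/

noncomputable section

namespace Summit.Ventures.Crystal3D.Theorems

open Summit.Ventures.Crystal3D Finset
open Literature.MathematicalPhysics.StatisticalMechanics (fccStacking contactDeficiency orderedContacts)
open scoped InnerProductSpace

/-- The ordered non-touching pairs, counted ball by ball. -/
theorem card_badOrd_eq_sum (S : Finset (EuclideanSpace ℝ (Fin 3))) :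
    ((S ×ˢ S).filter fun pq => pq.1 ≠ pq.2 ∧ dist pq.1 pq.2 ≠ 1).card =
      ∑ v ∈ S, (S.filter fun q => v ≠ q ∧ dist v q ≠ 1).card := by
  classical
  rw [Finset.card_filter, Finset.sum_product]
  refine Finset.sum_congr rfl fun v _ => ?_
  rw [Finset.card_filter]

/-- Erasing a ball removes exactly twice its non-touching degree. -/
theorem card_badOrd_erase (S : Finset (EuclideanSpace ℝ (Fin 3))) {v : EuclideanSpace ℝ (Fin 3)}
    (hv : v ∈ S) :
    (((S.erase v) ×ˢ (S.erase v)).filter fun pq => pq.1 ≠ pq.2 ∧ dist pq.1 pq.2 ≠ 1).card +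
        2 * (S.filter fun q => v ≠ q ∧ dist v q ≠ 1).card =
      ((S ×ˢ S).filter fun pq => pq.1 ≠ pq.2 ∧ dist pq.1 pq.2 ≠ 1).card := by
  classical
  set B := (S ×ˢ S).filter fun pq => pq.1 ≠ pq.2 ∧ dist pq.1 pq.2 ≠ 1 with hB
  set Dv := S.filter fun q => v ≠ q ∧ dist v q ≠ 1 with hDv
  have hsplit : B = (B.filter fun pq => pq.1 ≠ v ∧ pq.2 ≠ v) ∪ (B.filter fun pq => ¬ (pq.1 ≠ v ∧ pq.2 ≠ v)) :=
    (Finset.filter_union_filter_not_eq _ _).symm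
  have hdisj : Disjoint (B.filter fun pq => pq.1 ≠ v ∧ pq.2 ≠ v)
      (B.filter fun pq => ¬ (pq.1 ≠ v ∧ pq.2 ≠ v)) := Finset.disjoint_filter_filter_not _ _ _
  have h1 : (B.filter fun pq => pq.1 ≠ v ∧ pq.2 ≠ v) =
      ((S.erase v) ×ˢ (S.erase v)).filter fun pq => pq.1 ≠ pq.2 ∧ dist pq.1 pq.2 ≠ 1 := by
    ext pq
    simp only [hB, Finset.mem_filter, Finset.mem_product, Finset.mem_erase]
    tauto
  have h2 : (B.filter fun pq => ¬ (pq.1 ≠ v ∧ pq.2 ≠ v)) =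
      Dv.image (fun q => (v, q)) ∪ Dv.image (fun q => (q, v)) := by
    ext pq
    simp only [hB, hDv, Finset.mem_filter, Finset.mem_product, Finset.mem_union, Finset.mem_image]
    constructor
    · rintro ⟨⟨⟨h1, h2⟩, hne, hd⟩, hv'⟩
      by_cases e1 : pq.1 = v
      · left; refine ⟨pq.2, ⟨h2, ?_, ?_⟩, ?_⟩
        · rw [← e1]; exact hne
        · rw [← e1]; exact hd
        · rw [← e1]
      · have e2 : pq.2 = v := by
          by_contra e2; exact hv' ⟨e1, e2⟩
        right; refine ⟨pq.1, ⟨h1, ?_, ?_⟩, ?_⟩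
        · rw [← e2]; exact hne.symm
        · rw [← e2, dist_comm]; exact hd
        · rw [← e2]
    · rintro (⟨q, ⟨hq, hne, hd⟩, rfl⟩ | ⟨q, ⟨hq, hne, hd⟩, rfl⟩)
      · exact ⟨⟨⟨hv, hq⟩, hne, hd⟩, fun h => h.1 rfl⟩
      · exact ⟨⟨⟨hq, hv⟩, hne.symm, by rw [dist_comm]; exact hd⟩, fun h => h.2 rfl⟩
  have hdisj2 : Disjoint (Dv.image fun q => (v, q)) (Dv.image fun q => (q, v)) := by
    rw [Finset.disjoint_left]
    rintro pq h h'
    obtain ⟨q, hq, rfl⟩ := Finset.mem_image.1 h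
    obtain ⟨q', hq', e⟩ := Finset.mem_image.1 h'
    have : q' = v := congrArg Prod.fst e
    rw [this] at hq'
    exact (Finset.mem_filter.1 hq').2.1 rfl
  have hinj1 : Set.InjOn (fun q : EuclideanSpace ℝ (Fin 3) => (v, q))
      (↑Dv : Set (EuclideanSpace ℝ (Fin 3))) := fun q _ q' _ h => congrArg Prod.snd h
  have hinj2 : Set.InjOn (fun q : EuclideanSpace ℝ (Fin 3) => (q, v))
      (↑Dv : Set (EuclideanSpace ℝ (Fin 3))) := fun q _ q' _ h => congrArg Prod.fst h
  rw [hsplit, Finset.card_union_of_disjoint hdisj, h1, h2, Finset.card_union_of_disjoint hdisj2,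
    Finset.card_image_of_injOn hinj1, Finset.card_image_of_injOn hinj2]
  ring

/-- The greedy step: some ball meets `≥ 2` bad pairs, or all meet `≤ 1` (then `≤ #S` ordered pairs), or there are none. -/
theorem exists_erase_bad_step (S : Finset (EuclideanSpace ℝ (Fin 3))) (hS : S.Nonempty) :
    ∃ v ∈ S,
      (((S.erase v) ×ˢ (S.erase v)).filter fun pq => pq.1 ≠ pq.2 ∧ dist pq.1 pq.2 ≠ 1).card + 4 ≤
          ((S ×ˢ S).filter fun pq => pq.1 ≠ pq.2 ∧ dist pq.1 pq.2 ≠ 1).card ∨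
      (((S ×ˢ S).filter fun pq => pq.1 ≠ pq.2 ∧ dist pq.1 pq.2 ≠ 1).card ≤ S.card ∧
        (((S.erase v) ×ˢ (S.erase v)).filter fun pq => pq.1 ≠ pq.2 ∧ dist pq.1 pq.2 ≠ 1).card + 2 ≤
          ((S ×ˢ S).filter fun pq => pq.1 ≠ pq.2 ∧ dist pq.1 pq.2 ≠ 1).card) ∨
      ((S ×ˢ S).filter fun pq => pq.1 ≠ pq.2 ∧ dist pq.1 pq.2 ≠ 1).card = 0 := by
  classical
  by_cases h2 : ∃ v ∈ S, 2 ≤ (S.filter fun q => v ≠ q ∧ dist v q ≠ 1).card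
  · obtain ⟨v, hv, hd⟩ := h2
    refine ⟨v, hv, Or.inl ?_⟩
    have := card_badOrd_erase S hv
    omega
  · push Not at h2
    have hle : ((S ×ˢ S).filter fun pq => pq.1 ≠ pq.2 ∧ dist pq.1 pq.2 ≠ 1).card ≤ S.card := by
      rw [card_badOrd_eq_sum]
      calc ∑ v ∈ S, (S.filter fun q => v ≠ q ∧ dist v q ≠ 1).card ≤ ∑ v ∈ S, 1 :=
            Finset.sum_le_sum fun v hv => Nat.le_of_lt_succ (h2 v hv)
        _ = S.card := by simp
    by_cases h0 : ((S ×ˢ S).filter fun pq => pq.1 ≠ pq.2 ∧ dist pq.1 pq.2 ≠ 1).card = 0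
    · obtain ⟨v, hv⟩ := hS
      exact ⟨v, hv, Or.inr (Or.inr h0)⟩
    · -- some ball meets exactly one bad pair
      have hpos : 0 < ∑ v ∈ S, (S.filter fun q => v ≠ q ∧ dist v q ≠ 1).card := by
        rw [← card_badOrd_eq_sum]; omega
      obtain ⟨v, hv, hdv⟩ : ∃ v ∈ S, 0 < (S.filter fun q => v ≠ q ∧ dist v q ≠ 1).card := by
        by_contra hno
        push Not at hno
        have : ∑ v ∈ S, (S.filter fun q => v ≠ q ∧ dist v q ≠ 1).card = 0 :=
          Finset.sum_eq_zero fun v hv => Nat.le_zero.1 (hno v hv)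
        omega
      refine ⟨v, hv, Or.inr (Or.inl ⟨hle, ?_⟩)⟩
      have := card_badOrd_erase S hv
      omega

/-- **From nine points with `≤ 17` ordered non-touching pairs to six points with `≤ 5`.** -/
theorem exists_six_few_bad (S : Finset (EuclideanSpace ℝ (Fin 3))) (hS : S.card = 9)
    (hB : ((S ×ˢ S).filter fun pq => pq.1 ≠ pq.2 ∧ dist pq.1 pq.2 ≠ 1).card ≤ 17) :
    ∃ T ⊆ S, T.card = 6 ∧ ((T ×ˢ T).filter fun pq => pq.1 ≠ pq.2 ∧ dist pq.1 pq.2 ≠ 1).card ≤ 5 := by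
  classical
  obtain ⟨v₁, hv₁, h₁⟩ := exists_erase_bad_step S (Finset.card_pos.1 (by omega))
  set S₁ := S.erase v₁ with hS₁
  have hS₁c : S₁.card = 8 := by rw [hS₁, Finset.card_erase_of_mem hv₁, hS]
  have hB₁ : ((S₁ ×ˢ S₁).filter fun pq => pq.1 ≠ pq.2 ∧ dist pq.1 pq.2 ≠ 1).card ≤ 13 := by
    rcases h₁ with h | ⟨h, h'⟩ | h
    · omega
    · omega
    · have := card_badOrd_erase S hv₁; rw [← hS₁] at this; omega
  obtain ⟨v₂, hv₂, h₂⟩ := exists_erase_bad_step S₁ (Finset.card_pos.1 (by omega))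
  set S₂ := S₁.erase v₂ with hS₂
  have hS₂c : S₂.card = 7 := by rw [hS₂, Finset.card_erase_of_mem hv₂, hS₁c]
  have hB₂ : ((S₂ ×ˢ S₂).filter fun pq => pq.1 ≠ pq.2 ∧ dist pq.1 pq.2 ≠ 1).card ≤ 9 := by
    rcases h₂ with h | ⟨h, h'⟩ | h
    · omega
    · omega
    · have := card_badOrd_erase S₁ hv₂; rw [← hS₂] at this; omega
  obtain ⟨v₃, hv₃, h₃⟩ := exists_erase_bad_step S₂ (Finset.card_pos.1 (by omega))
  set S₃ := S₂.erase v₃ with hS₃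
  have hS₃c : S₃.card = 6 := by rw [hS₃, Finset.card_erase_of_mem hv₃, hS₂c]
  have hB₃ : ((S₃ ×ˢ S₃).filter fun pq => pq.1 ≠ pq.2 ∧ dist pq.1 pq.2 ≠ 1).card ≤ 5 := by
    rcases h₃ with h | ⟨h, h'⟩ | h
    · omega
    · omega
    · have := card_badOrd_erase S₂ hv₃; rw [← hS₃] at this; omega
  refine ⟨S₃, ?_, hS₃c, hB₃⟩
  calc S₃ ⊆ S₂ := Finset.erase_subset _ _
    _ ⊆ S₁ := Finset.erase_subset _ _
    _ ⊆ S := Finset.erase_subset _ _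

/-- Five points of `ℝ³` pairwise at distance `1` do not exist (rescaled `no_five_pairwise_dist_two`). -/
theorem false_of_five_pairwise_touching (T : Finset (EuclideanSpace ℝ (Fin 3))) (hT : T.card = 5)
    (hgood : ∀ x ∈ T, ∀ y ∈ T, x ≠ y → dist x y = 1) : False := by
  have e : Fin 5 ≃ T := (T.equivFin.trans (finCongr hT)).symm
  refine Literature.Barriers.AtomisticToContinuum.no_five_pairwise_dist_two
    (fun i => (2 : ℝ) • ((e i : T) : EuclideanSpace ℝ (Fin 3))) fun i j hij => ?_
  have hne : ((e i : T) : EuclideanSpace ℝ (Fin 3)) ≠ (e j : T) := fun h =>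
    hij (e.injective (Subtype.ext h))
  have h1 := hgood _ (e i).2 _ (e j).2 hne
  rw [dist_smul₀, h1]
  norm_num

/-- **Six points of `ℝ³` with `≤ 5` ordered non-touching pairs do not exist** (a covering point ⇒ `K₅`; else `K_{1,1,2,2}`). -/
theorem six_few_bad_false (T : Finset (EuclideanSpace ℝ (Fin 3))) (hT : T.card = 6)
    (hB : ((T ×ˢ T).filter fun pq => pq.1 ≠ pq.2 ∧ dist pq.1 pq.2 ≠ 1).card ≤ 5) : False := by
  classical
  set B := (T ×ˢ T).filter fun pq => pq.1 ≠ pq.2 ∧ dist pq.1 pq.2 ≠ 1 with hBdef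
  set Bl := B.filter fun p => WellOrderingRel p.1 p.2 with hBl
  have hBl2 : 2 * Bl.card ≤ B.card := by
    have hmap : Bl.image Prod.swap ⊆ B \ Bl := by
      intro p hp
      obtain ⟨p', hp', rfl⟩ := Finset.mem_image.1 hp
      rw [hBl, Finset.mem_filter, hBdef, Finset.mem_filter, Finset.mem_product] at hp'
      obtain ⟨⟨⟨h1, h2⟩, hne, hd⟩, hw⟩ := hp'
      rw [Finset.mem_sdiff, hBl, Finset.mem_filter, hBdef, Finset.mem_filter, Finset.mem_product]
      refine ⟨⟨⟨h2, h1⟩, hne.symm, by rw [Prod.fst_swap, Prod.snd_swap, dist_comm]; exact hd⟩, ?_⟩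
      rintro ⟨-, hw'⟩
      rw [Prod.fst_swap, Prod.snd_swap] at hw'
      exact wellOrderingRel_asymm hw hw'
    have hinj : Set.InjOn Prod.swap (Bl : Set (EuclideanSpace ℝ (Fin 3) × EuclideanSpace ℝ (Fin 3))) :=
      fun p _ p' _ h => Prod.swap_injective h
    have hsubB : Bl ⊆ B := by rw [hBl]; exact Finset.filter_subset _ _
    have h1 := Finset.card_le_card hmap
    rw [Finset.card_image_of_injOn hinj, Finset.card_sdiff_of_subset hsubB] at h1
    have h2 := Finset.card_le_card hsubB
    omega
  have hBlcard : Bl.card ≤ 2 := by omega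
  have hrep : ∀ x ∈ T, ∀ y ∈ T, x ≠ y → dist x y ≠ 1 → (x, y) ∈ Bl ∨ (y, x) ∈ Bl := by
    intro x hx y hy hne hd
    rcases wellOrderingRel_or hne with hxy | hyx
    · left
      rw [hBl, Finset.mem_filter, hBdef, Finset.mem_filter, Finset.mem_product]
      exact ⟨⟨⟨hx, hy⟩, hne, hd⟩, hxy⟩
    · right
      rw [hBl, Finset.mem_filter, hBdef, Finset.mem_filter, Finset.mem_product]
      exact ⟨⟨⟨hy, hx⟩, hne.symm, by rw [dist_comm]; exact hd⟩, hyx⟩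
  have hmemBl : ∀ pq ∈ Bl, pq.1 ∈ T ∧ pq.2 ∈ T ∧ pq.1 ≠ pq.2 ∧ dist pq.1 pq.2 ≠ 1 := by
    intro pq hpq
    rw [hBl, Finset.mem_filter, hBdef, Finset.mem_filter, Finset.mem_product] at hpq
    exact ⟨hpq.1.1.1, hpq.1.1.2, hpq.1.2.1, hpq.1.2.2⟩
  by_cases hcov : ∃ w ∈ T, ∀ pq ∈ Bl, pq.1 = w ∨ pq.2 = w
  · -- erase `w`: five pairwise touching points
    obtain ⟨w, hw, hwcov⟩ := hcov
    refine false_of_five_pairwise_touching (T.erase w) (by rw [Finset.card_erase_of_mem hw, hT])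
      fun x hx y hy hne => ?_
    obtain ⟨hxw, hxT⟩ := Finset.mem_erase.1 hx
    obtain ⟨hyw, hyT⟩ := Finset.mem_erase.1 hy
    by_contra hd
    rcases hrep x hxT y hyT hne hd with h | h
    · rcases hwcov _ h with e | e
      · exact hxw e
      · exact hyw e
    · rcases hwcov _ h with e | e
      · exact hyw e
      · exact hxw e
  · -- no covering point: exactly two disjoint bad pairs `(b,b')`, `(c,c')`
    push Not at hcov
    have hTne : T.Nonempty := Finset.card_pos.1 (by omega)
    have hBl_two : Bl.card = 2 := by
      refine le_antisymm hBlcard ?_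
      by_contra hlt
      push Not at hlt
      rcases Nat.lt_succ_iff.1 hlt |> Nat.le_one_iff_eq_zero_or_eq_one.1 with h0 | h1
      · obtain ⟨w, hw⟩ := hTne
        obtain ⟨pq, hpq, hne⟩ := hcov w hw
        rw [Finset.card_eq_zero] at h0
        rw [h0] at hpq; exact absurd hpq (Finset.notMem_empty _)
      · obtain ⟨e, he⟩ := Finset.card_eq_one.1 h1
        have heT := hmemBl e (by rw [he]; exact Finset.mem_singleton_self e)
        obtain ⟨pq, hpq, hne⟩ := hcov e.1 heT.1
        rw [he, Finset.mem_singleton] at hpq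
        exact hne.1 (by rw [hpq])
    obtain ⟨e₁, e₂, hne12, hBl12⟩ := Finset.card_eq_two.1 hBl_two
    have he₁ := hmemBl e₁ (by rw [hBl12]; simp)
    have he₂ := hmemBl e₂ (by rw [hBl12]; simp)
    have hdis : e₁.1 ≠ e₂.1 ∧ e₁.1 ≠ e₂.2 ∧ e₁.2 ≠ e₂.1 ∧ e₁.2 ≠ e₂.2 := by
      refine ⟨fun h => ?_, fun h => ?_, fun h => ?_, fun h => ?_⟩
      · obtain ⟨pq, hpq, hne⟩ := hcov e₁.1 he₁.1
        rw [hBl12, Finset.mem_insert, Finset.mem_singleton] at hpq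
        rcases hpq with rfl | rfl
        · exact hne.1 rfl
        · exact hne.1 h.symm
      · obtain ⟨pq, hpq, hne⟩ := hcov e₁.1 he₁.1
        rw [hBl12, Finset.mem_insert, Finset.mem_singleton] at hpq
        rcases hpq with rfl | rfl
        · exact hne.1 rfl
        · exact hne.2 h.symm
      · obtain ⟨pq, hpq, hne⟩ := hcov e₁.2 he₁.2.1
        rw [hBl12, Finset.mem_insert, Finset.mem_singleton] at hpq
        rcases hpq with rfl | rfl
        · exact hne.2 rfl
        · exact hne.1 h.symm
      · obtain ⟨pq, hpq, hne⟩ := hcov e₁.2 he₁.2.1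
        rw [hBl12, Finset.mem_insert, Finset.mem_singleton] at hpq
        rcases hpq with rfl | rfl
        · exact hne.2 rfl
        · exact hne.2 h.symm
    set b := e₁.1; set b' := e₁.2; set c := e₂.1; set c' := e₂.2
    set R := ((T.erase b).erase b').erase c |>.erase c' with hR
    have hRcard : R.card = 2 := by
      have h1 : (T.erase b).card = 5 := by rw [Finset.card_erase_of_mem he₁.1, hT]
      have m2 : b' ∈ T.erase b := Finset.mem_erase.2 ⟨he₁.2.2.1.symm, he₁.2.1⟩
      have h2 : ((T.erase b).erase b').card = 4 := by rw [Finset.card_erase_of_mem m2, h1]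
      have m3 : c ∈ (T.erase b).erase b' :=
        Finset.mem_erase.2 ⟨hdis.2.2.1.symm, Finset.mem_erase.2 ⟨hdis.1.symm, he₂.1⟩⟩
      have h3 : (((T.erase b).erase b').erase c).card = 3 := by rw [Finset.card_erase_of_mem m3, h2]
      have m4 : c' ∈ ((T.erase b).erase b').erase c :=
        Finset.mem_erase.2 ⟨he₂.2.2.1.symm, Finset.mem_erase.2 ⟨hdis.2.2.2.symm,
          Finset.mem_erase.2 ⟨hdis.2.1.symm, he₂.2.1⟩⟩⟩
      rw [hR, Finset.card_erase_of_mem m4, h3]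
    obtain ⟨u, a, hua, hRua⟩ := Finset.card_eq_two.1 hRcard
    have hmemR : ∀ z ∈ R, z ∈ T ∧ z ≠ b ∧ z ≠ b' ∧ z ≠ c ∧ z ≠ c' := by
      intro z hz
      rw [hR] at hz
      simp only [Finset.mem_erase] at hz
      exact ⟨hz.2.2.2.2, hz.2.2.2.1, hz.2.2.1, hz.2.1, hz.1⟩
    have hu := hmemR u (by rw [hRua]; simp)
    have ha := hmemR a (by rw [hRua]; simp)
    have good : ∀ x ∈ T, ∀ y ∈ T, x ≠ y → ¬ ((x = b ∧ y = b') ∨ (x = b' ∧ y = b) ∨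
        (x = c ∧ y = c') ∨ (x = c' ∧ y = c)) → dist x y = 1 := by
      intro x hx y hy hne hnot
      by_contra hd
      rcases hrep x hx y hy hne hd with h | h
      · rw [hBl12, Finset.mem_insert, Finset.mem_singleton] at h
        rcases h with h | h
        · exact hnot (Or.inl ⟨congrArg Prod.fst h, congrArg Prod.snd h⟩)
        · exact hnot (Or.inr (Or.inr (Or.inl ⟨congrArg Prod.fst h, congrArg Prod.snd h⟩)))
      · rw [hBl12, Finset.mem_insert, Finset.mem_singleton] at h
        rcases h with h | h
        · exact hnot (Or.inr (Or.inl ⟨congrArg Prod.snd h, congrArg Prod.fst h⟩))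
        · exact hnot (Or.inr (Or.inr (Or.inr ⟨congrArg Prod.snd h, congrArg Prod.fst h⟩)))
    have key : ∀ x ∈ T, x ≠ b → x ≠ b' → x ≠ c → x ≠ c' → ∀ y ∈ T, x ≠ y → dist x y = 1 := by
      intro x hx h1 h2 h3 h4 y hy hne
      refine good x hx y hy hne ?_
      rintro (⟨h, -⟩ | ⟨h, -⟩ | ⟨h, -⟩ | ⟨h, -⟩)
      · exact h1 h
      · exact h2 h
      · exact h3 h
      · exact h4 h
    have hbc : dist b c = 1 := by
      refine good b he₁.1 c he₂.1 hdis.1 ?_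
      rintro (⟨-, h⟩ | ⟨h, -⟩ | ⟨h, -⟩ | ⟨h, -⟩)
      · exact hdis.2.2.1 h.symm
      · exact he₁.2.2.1 h
      · exact hdis.1 h
      · exact hdis.2.1 h
    have hbc' : dist b c' = 1 := by
      refine good b he₁.1 c' he₂.2.1 hdis.2.1 ?_
      rintro (⟨-, h⟩ | ⟨h, -⟩ | ⟨h, -⟩ | ⟨h, -⟩)
      · exact hdis.2.2.2 h.symm
      · exact he₁.2.2.1 h
      · exact hdis.1 h
      · exact hdis.2.1 h
    have hb'c : dist b' c = 1 := by
      refine good b' he₁.2.1 c he₂.1 hdis.2.2.1 ?_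
      rintro (⟨h, -⟩ | ⟨-, h⟩ | ⟨h, -⟩ | ⟨h, -⟩)
      · exact he₁.2.2.1 h.symm
      · exact hdis.1 h.symm
      · exact hdis.2.2.1 h
      · exact hdis.2.2.2 h
    have hb'c' : dist b' c' = 1 := by
      refine good b' he₁.2.1 c' he₂.2.1 hdis.2.2.2 ?_
      rintro (⟨h, -⟩ | ⟨-, h⟩ | ⟨h, -⟩ | ⟨h, -⟩)
      · exact he₁.2.2.1 h.symm
      · exact hdis.2.1 h.symm
      · exact hdis.2.2.1 h
      · exact hdis.2.2.2 h
    exact no_K1122_contacts u a b b' c c' he₁.2.2.1 he₂.2.2.1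
      (key u hu.1 hu.2.1 hu.2.2.1 hu.2.2.2.1 hu.2.2.2.2 a ha.1 hua)
      (key u hu.1 hu.2.1 hu.2.2.1 hu.2.2.2.1 hu.2.2.2.2 b he₁.1 hu.2.1)
      (key u hu.1 hu.2.1 hu.2.2.1 hu.2.2.2.1 hu.2.2.2.2 b' he₁.2.1 hu.2.2.1)
      (key u hu.1 hu.2.1 hu.2.2.1 hu.2.2.2.1 hu.2.2.2.2 c he₂.1 hu.2.2.2.1)
      (key u hu.1 hu.2.1 hu.2.2.1 hu.2.2.2.1 hu.2.2.2.2 c' he₂.2.1 hu.2.2.2.2)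
      (key a ha.1 ha.2.1 ha.2.2.1 ha.2.2.2.1 ha.2.2.2.2 b he₁.1 ha.2.1)
      (key a ha.1 ha.2.1 ha.2.2.1 ha.2.2.2.1 ha.2.2.2.2 b' he₁.2.1 ha.2.2.1)
      (key a ha.1 ha.2.1 ha.2.2.1 ha.2.2.2.1 ha.2.2.2.2 c he₂.1 ha.2.2.2.1)
      (key a ha.1 ha.2.1 ha.2.2.1 ha.2.2.2.1 ha.2.2.2.2 c' he₂.2.1 ha.2.2.2.2)
      hbc hbc' hb'c hb'c'

open scoped Classical in
/-- **A criminal has at least ten off-lattice balls.** -/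
theorem ten_le_card_offLattice_of_criminal {ν : EuclideanSpace ℝ (Fin 3)} {s : ℝ}
    {Q : Finset (EuclideanSpace ℝ (Fin 3))} (hQ : IsCriminal ν s Q) :
    10 ≤ (Q.filter fun y => y ∉ fccStacking 1 (Real.sqrt (2 / 3))).card := by
  set O := Q.filter fun y => y ∉ fccStacking 1 (Real.sqrt (2 / 3)) with hO
  have h9 : 9 ≤ O.card := nine_le_card_offLattice_of_criminal hQ
  by_contra hlt
  push Not at hlt
  have hcard : O.card = 9 := by omega
  have hD := contactDeficiency_offLattice_lt_of_criminal hQ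
  rw [← hO] at hD
  have hdef : contactDeficiency O = 6 * (O.card : ℝ) - (orderedContacts O : ℝ) / 2 := rfl
  rw [hdef, hcard] at hD
  have h54 : 54 < orderedContacts O := by
    have : (54 : ℝ) < orderedContacts O := by push_cast at hD; linarith
    exact_mod_cast this
  set B := (O ×ˢ O).filter fun p => p.1 ≠ p.2 ∧ dist p.1 p.2 ≠ 1 with hB
  have hBcard : B.card ≤ 17 := by
    have hsplit : ((O ×ˢ O).filter fun p => p.1 ≠ p.2).card =
        ((O ×ˢ O).filter fun p => dist p.1 p.2 = 1).card + B.card := by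
      rw [hB, ← Finset.card_union_of_disjoint]
      · congr 1
        ext p
        simp only [Finset.mem_filter, Finset.mem_union]
        constructor
        · rintro ⟨hp, hne⟩
          by_cases hd : dist p.1 p.2 = 1
          · exact Or.inl ⟨hp, hd⟩
          · exact Or.inr ⟨hp, hne, hd⟩
        · rintro (⟨hp, hd⟩ | ⟨hp, hne, _⟩)
          · refine ⟨hp, fun h => ?_⟩
            rw [h, dist_self] at hd; norm_num at hd
          · exact ⟨hp, hne⟩
      · rw [Finset.disjoint_left]
        rintro p hp hp'
        exact (Finset.mem_filter.1 hp').2.2 (Finset.mem_filter.1 hp).2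
    have hoff : ((O ×ˢ O).filter fun p => p.1 ≠ p.2).card = O.card * (O.card - 1) := by
      have hoff' : ((O ×ˢ O).filter fun p => p.1 ≠ p.2) = O.offDiag := by
        ext p
        simp only [Finset.mem_filter, Finset.mem_product, Finset.mem_offDiag, and_assoc]
      rw [hoff', Finset.offDiag_card, Nat.mul_sub_one]
    rw [hoff, hcard] at hsplit
    have : ((O ×ˢ O).filter fun p => dist p.1 p.2 = 1).card = orderedContacts O := rfl
    omega
  obtain ⟨T, -, hT6, hTB⟩ := exists_six_few_bad O hcard hBcard
  exact six_few_bad_false T hT6 hTB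

end Summit.Ventures.Crystal3D.Theorems

end
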